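import Summits.QuantumFields.BalabanUV.T4Continuum.Support.NE7MeanZeroGaugeSliceW
import Summits.QuantumFields.BalabanUV.T4Continuum.Support.NE3RightInverseSupLetters
import Summits.QuantumFields.BalabanUV.T4Continuum.Support.PeriodicChoice
import HarnessLib

/-!
# NE7EnergySliceClosed — `𝒯_E(W)` IS CLOSED UNDER SITEWISE LIMITS (memo ROAD-G100 §2.5, the closing step of the Cauchy engine `NE7DefectIterationCauchy`): a sitewise limit of
# slice elements `Y_m ∈ energyBlockLandauW L N (k+1) W` is a slice element — periodic fields converge sitewise iff uniformly, `Q̄` is linear and sup-bounded in the class, the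
# orthogonality is a finite sum of `hsR`-pairings

Cell `pub-balaban`, rung (B)+1 sub-cell t4, lineage `b2b-balaban-t4-ne7-p1`, generation 100 (CRUX PROVER NE7 #1 = OWNER of BINDER row NE7).  Memo `t4/b2b-balaban-t4-ne7-p1-g100/ROAD-G100.md` §2.5:
the supplier (S1) produces the exact `𝒯_E`-slice representative as the sitewise LIMIT of an orbit of regaugings (`NE7DefectIterationCauchy.exists_limit_gauge`); along the orbit the tangent
parts `T(u_j) = Ỹ_j + (defect_j)` have `Ỹ_j ∈ 𝒯_E(W)` and `defect_j → 0`, so `T(u_*) = lim Ỹ_j`, and exactness `T(u_*) ∈ 𝒯_E(W)` is THIS FILE: the slice is closed under sitewise limits.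
WHAT ([folklore]; 0 def, 0 sorry).
§1 `unif_of_tendsto_periodic` (periodic fields of one period: sitewise convergence ⟹ uniform convergence, `∀ ε > 0, ∀ᶠ m, ∀ y μ, ‖Y_m y μ − Y y μ‖ ≤ ε`); `skew_of_tendsto`, `periodic_of_tendsto`.
§2 `QbarIter_sub` (class linearity); **`QbarIter_eq_zero_of_tendsto`** (`Q̄Y_m = 0`, `Y_m → Y` sitewise, all of one period ⟹ `Q̄Y = 0`, by the sup letter `NE3RightInverseSupLetters.norm_QbarIter_le_two_mul_of_sup`).
§3 `orthogonal_of_tendsto` (finite `hsR`-sums, `abs_hsR_le`); **`mem_energyBlockLandauW_of_tendsto`**: `Y_m ∈ energyBlockLandauW L N (j+1) W` for all `m`, `Y_m → Y` sitewise ⟹ `Y ∈ energyBlockLandauW L N (j+1) W`.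
HONEST FRAMING (page 1): elementary limits at ONE background; nothing of Bałaban's asserted; NOT (L), NOT (S1), NOT NE7; spine 0∕9; finite T⁴ rung (B)+1 — NOT infinite volume, NOT mass gap, NOT
BetaPertH, NOT Clay.  Continuum YM on T⁴ ⇐ BetaPertH ∧ nine spine estimates (0/9 proved); BetaPertH ⇐ (D1) ∧ (D4) ∧ CAP+tail; G-an2-4 gates asym, D1 and NE2/3/4.
-/

set_option autoImplicit false

open scoped BigOperators Matrix.Norms.L2Operator
open Filter Topology Finset

namespace Summit.QuantumFields.BalabanUV.T4Continuum.NE7EnergySliceClosed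

open Literature.MathematicalPhysics.QuantumFieldTheory.Balaban1983to89
open B7Prop1Explicit B7Prop2Explicit
open T4AveragingDeficitWall (IsUnitaryCfg IsSkewDir SmallField)
open T4AveragingDeficitWallBoundary (periodBox)
open AveragingDeficitPeriodicCounting (IsPeriodicDir)
open AveragingDeficitMultiLevelPrep (LevelSmall tower)
open BlockAveragePushDirGauge (gaugeDir)
open NE3TangentCovariantTower (QbarIter)
open NE3CovariantCalculus (hsR hsR_sub_left abs_hsR_le)
open NE3CovariantLineSumsTower (QbarIter_add)
open NE3RightInverseSupLetters (norm_QbarIter_le_two_mul_of_sup)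
open NE7MeanZeroGaugeSliceW (energyBlockLandauW meanZeroGaugeSpaceW)
open PeriodicChoice (apply_wrap_eq wrap_mem_periodBox)

noncomputable section

variable {d : ℕ} {n : Type*} [Fintype n] [DecidableEq n]

/-! ## §1 Sitewise limits of periodic fields -/

/-- **SITEWISE ⟹ UNIFORM for fields of one period**: if every `Y_m` and `Y` are `P`-periodic (`P ≥ 1`) and `Y_m y μ → Y y μ` at every bond, then for every `ε > 0` eventually
`‖Y_m y μ − Y y μ‖ ≤ ε` at EVERY bond (finitely many bonds in the period box). [folklore] -/
theorem unif_of_tendsto_periodic {Y : ℕ → Site d → Fin d → Matrix n n ℂ} {Yl : Site d → Fin d → Matrix n n ℂ} {P : ℕ} (hP : 1 ≤ P)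
    (hYP : ∀ m, IsPeriodicDir (Y m) (P : ℤ)) (hYlP : IsPeriodicDir Yl (P : ℤ))
    (hlim : ∀ (y : Site d) (μ : Fin d), Tendsto (fun m => Y m y μ) atTop (𝓝 (Yl y μ))) {ε : ℝ} (hε : 0 < ε) :
    ∀ᶠ m in atTop, ∀ (y : Site d) (μ : Fin d), ‖Y m y μ - Yl y μ‖ ≤ ε := by
  have hfin : ∀ᶠ m in atTop, ∀ p ∈ (periodBox (d := d) P) ×ˢ (univ : Finset (Fin d)), ‖Y m p.1 p.2 - Yl p.1 p.2‖ ≤ ε := by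
    refine (eventually_all_finset _).mpr fun p _ => ?_
    have h := (NormedAddCommGroup.tendsto_atTop.mp (hlim p.1 p.2)) ε hε
    obtain ⟨N, hN⟩ := h
    exact eventually_atTop.mpr ⟨N, fun m hm => (hN m hm).le⟩
  refine hfin.mono fun m hm y μ => ?_
  -- reduce the bond to the period box
  have hF : ∀ (z : Site d) (κ : Fin d), (fun w => Y m w μ - Yl w μ) (z + (P : ℤ) • e κ) = (fun w => Y m w μ - Yl w μ) z := fun z κ => by
    simp only [hYP m z κ μ, hYlP z κ μ]
  have hw := apply_wrap_eq (g := fun w => Y m w μ - Yl w μ) hF y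
  rw [← hw]
  exact hm ⟨fun κ => y κ % (P : ℤ), μ⟩ (Finset.mem_product.mpr ⟨wrap_mem_periodBox P hP y, Finset.mem_univ _⟩)

omit [Fintype n] [DecidableEq n] in
/-- a sitewise limit of skew fields is skew. [folklore] -/
theorem skew_of_tendsto {Y : ℕ → Site d → Fin d → Matrix n n ℂ} {Yl : Site d → Fin d → Matrix n n ℂ} (hYs : ∀ m, IsSkewDir (Y m))
    (hlim : ∀ (y : Site d) (μ : Fin d), Tendsto (fun m => Y m y μ) atTop (𝓝 (Yl y μ))) : IsSkewDir Yl := by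
  intro y μ
  rw [skewAdjoint.mem_iff]
  have h1 : Tendsto (fun m => star (Y m y μ)) atTop (𝓝 (star (Yl y μ))) := (hlim y μ).star
  have h2 : Tendsto (fun m => -Y m y μ) atTop (𝓝 (-Yl y μ)) := (hlim y μ).neg
  have he : (fun m => star (Y m y μ)) = fun m => -Y m y μ := funext fun m => skewAdjoint.mem_iff.mp (hYs m y μ)
  rw [he] at h1
  exact tendsto_nhds_unique h1 h2

omit [Fintype n] [DecidableEq n] in
/-- a sitewise limit of `P`-periodic fields is `P`-periodic. [folklore] -/
theorem periodic_of_tendsto {Y : ℕ → Site d → Fin d → Matrix n n ℂ} {Yl : Site d → Fin d → Matrix n n ℂ} {P : ℤ} (hYP : ∀ m, IsPeriodicDir (Y m) P)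
    (hlim : ∀ (y : Site d) (μ : Fin d), Tendsto (fun m => Y m y μ) atTop (𝓝 (Yl y μ))) : IsPeriodicDir Yl P := by
  intro y κ μ
  have he : (fun m => Y m (y + P • e κ) μ) = fun m => Y m y μ := funext fun m => hYP m y κ μ
  have h1 := hlim (y + P • e κ) μ
  rw [he] at h1
  exact tendsto_nhds_unique h1 (hlim y μ)

/-! ## §2 `Q̄ = 0` passes to the limit -/

/-- class linearity: `Q̄(A − B) = Q̄A − Q̄B`. [folklore] -/
theorem QbarIter_sub [Nonempty n] {L : ℕ} (hL : 1 ≤ L) (j : ℕ) {W : Site d → Fin d → (Matrix n n ℂ)ˣ} {x : ℝ}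
    (hWu : IsUnitaryCfg W) (hx : 0 ≤ x) (hs : LevelSmall d L j x) (hWx : SmallField W x) (A B : Site d → Fin d → Matrix n n ℂ) :
    QbarIter L (j + 1) W (fun y μ => A y μ - B y μ) = fun z κ => QbarIter L (j + 1) W A z κ - QbarIter L (j + 1) W B z κ := by
  have h := QbarIter_add hL j hWu hx hs hWx (fun y μ => A y μ - B y μ) B
  have e : (fun y μ => (A y μ - B y μ) + B y μ) = A := by funext y μ; abel
  simp only [e] at h
  funext z κ
  have hz := congr_fun (congr_fun h z) κ
  rw [hz]; abel

/-- **`Q̄ = 0` IS CLOSED UNDER SITEWISE LIMITS** (multi-level small-field class at level `j+1`, `2 ≤ L`): `Q̄Y_m = 0` for all `m`, all `Y_m` and `Y` of period `P ≥ 1`, `Y_m → Y` sitewise ⟹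
`Q̄Y = 0` (`Q̄Y = Q̄(Y − Y_m)` is bounded by `2M·sup‖Y − Y_m‖ → 0`). [folklore] -/
theorem QbarIter_eq_zero_of_tendsto [Nonempty n] {L : ℕ} (hL : 2 ≤ L) (j : ℕ) {W : Site d → Fin d → (Matrix n n ℂ)ˣ} {x : ℝ}
    (hWu : IsUnitaryCfg W) (hx : 0 ≤ x) (hs : LevelSmall d L j x) (hWx : SmallField W x)
    {Y : ℕ → Site d → Fin d → Matrix n n ℂ} {Yl : Site d → Fin d → Matrix n n ℂ} {P : ℕ} (hP : 1 ≤ P)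
    (hYP : ∀ m, IsPeriodicDir (Y m) (P : ℤ)) (hYlP : IsPeriodicDir Yl (P : ℤ))
    (hlim : ∀ (y : Site d) (μ : Fin d), Tendsto (fun m => Y m y μ) atTop (𝓝 (Yl y μ)))
    (hQ : ∀ m, QbarIter L (j + 1) W (Y m) = 0) : QbarIter L (j + 1) W Yl = 0 := by
  have hL1 : 1 ≤ L := by omega
  funext z κ
  rw [Pi.zero_apply, Pi.zero_apply, ← norm_le_zero_iff]
  refine le_of_forall_pos_le_add fun ε hε => ?_
  rw [zero_add]
  have hM : (0 : ℝ) < 2 * (L : ℝ) ^ (j + 1) := by positivity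
  obtain ⟨m, hm⟩ := (unif_of_tendsto_periodic hP hYP hYlP hlim (div_pos hε hM)).exists
  -- `Q̄Yl = Q̄(Yl − Y_m)`
  have hdiff : QbarIter L (j + 1) W Yl z κ = QbarIter L (j + 1) W (fun y μ => Yl y μ - Y m y μ) z κ := by
    rw [QbarIter_sub hL1 j hWu hx hs hWx, hQ m]
    simp
  rw [hdiff]
  have hb := norm_QbarIter_le_two_mul_of_sup hL j hWu hx hs hWx (fun y μ => Yl y μ - Y m y μ) (div_pos hε hM).le
    (fun y μ => by rw [norm_sub_rev]; exact hm y μ) (j + 1) le_rfl z κ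
  refine hb.trans (le_of_eq ?_)
  field_simp

/-! ## §3 The orthogonality passes to the limit; the slice is closed -/

/-- a finite sum of `hsR`-pairings against a fixed field passes to the sitewise limit: `Σ hsR (Y_m) G = 0` for all `m` ⟹ `Σ hsR Y G = 0`. [folklore] -/
theorem orthogonal_of_tendsto {Y : ℕ → Site d → Fin d → Matrix n n ℂ} {Yl : Site d → Fin d → Matrix n n ℂ} (S : Finset (Site d)) (G : Site d → Fin d → Matrix n n ℂ)
    (hlim : ∀ (y : Site d) (μ : Fin d), Tendsto (fun m => Y m y μ) atTop (𝓝 (Yl y μ)))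
    (h0 : ∀ m, ∑ y ∈ S, ∑ κ : Fin d, hsR (Y m y κ) (G y κ) = 0) :
    ∑ y ∈ S, ∑ κ : Fin d, hsR (Yl y κ) (G y κ) = 0 := by
  -- the pairing is continuous in the first slot (Lipschitz: `|hsR A G − hsR A′ G| ≤ ‖A − A′‖‖G‖`)
  have hcont : ∀ (y : Site d) (κ : Fin d), Tendsto (fun m => hsR (Y m y κ) (G y κ)) atTop (𝓝 (hsR (Yl y κ) (G y κ))) := by
    intro y κ
    rw [Metric.tendsto_atTop]
    intro ε hε
    have hG1 : (0 : ℝ) < ‖G y κ‖ + 1 := by positivity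
    obtain ⟨N, hN⟩ := (NormedAddCommGroup.tendsto_atTop.mp (hlim y κ)) (ε / (‖G y κ‖ + 1)) (div_pos hε hG1)
    refine ⟨N, fun m hm => ?_⟩
    rw [Real.dist_eq, ← hsR_sub_left]
    calc |hsR (Y m y κ - Yl y κ) (G y κ)| ≤ ‖Y m y κ - Yl y κ‖ * ‖G y κ‖ := abs_hsR_le _ _
      _ ≤ ε / (‖G y κ‖ + 1) * ‖G y κ‖ := mul_le_mul_of_nonneg_right (hN m hm).le (norm_nonneg _)
      _ < ε := by
          rw [div_mul_eq_mul_div, div_lt_iff₀ hG1]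
          nlinarith [norm_nonneg (G y κ)]
  have hsum : Tendsto (fun m => ∑ y ∈ S, ∑ κ : Fin d, hsR (Y m y κ) (G y κ)) atTop (𝓝 (∑ y ∈ S, ∑ κ : Fin d, hsR (Yl y κ) (G y κ))) :=
    tendsto_finsetSum _ fun y _ => tendsto_finsetSum _ fun κ _ => hcont y κ
  have he : (fun m => ∑ y ∈ S, ∑ κ : Fin d, hsR (Y m y κ) (G y κ)) = fun _ => 0 := funext h0
  rw [he] at hsum
  exact tendsto_nhds_unique hsum tendsto_const_nhds

/-- **`𝒯_E(W)` IS CLOSED UNDER SITEWISE LIMITS** (multi-level small-field class at level `j+1`, `2 ≤ L`, `N ≥ 1`): `Y_m ∈ energyBlockLandauW L N (j+1) W` for every `m` and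
`Y_m y μ → Y y μ` at every bond ⟹ `Y ∈ energyBlockLandauW L N (j+1) W`. [folklore] -/
theorem mem_energyBlockLandauW_of_tendsto [Nonempty n] {L N : ℕ} [NeZero N] (hL : 2 ≤ L) (j : ℕ) {W : Site d → Fin d → (Matrix n n ℂ)ˣ} {x : ℝ}
    (hWu : IsUnitaryCfg W) (hx : 0 ≤ x) (hs : LevelSmall d L j x) (hWx : SmallField W x)
    {Y : ℕ → Site d → Fin d → Matrix n n ℂ} {Yl : Site d → Fin d → Matrix n n ℂ}
    (hY : ∀ m, Y m ∈ energyBlockLandauW (d := d) (n := n) L N (j + 1) W)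
    (hlim : ∀ (y : Site d) (μ : Fin d), Tendsto (fun m => Y m y μ) atTop (𝓝 (Yl y μ))) :
    Yl ∈ energyBlockLandauW (d := d) (n := n) L N (j + 1) W := by
  haveI : NeZero L := ⟨by omega⟩
  have hP1 : 1 ≤ tower L N (j + 1) := Nat.one_le_iff_ne_zero.mpr (NeZero.ne _)
  have hYlP : IsPeriodicDir Yl ((tower L N (j + 1) : ℕ) : ℤ) := periodic_of_tendsto (fun m => (hY m).2.1) hlim
  refine ⟨skew_of_tendsto (fun m => (hY m).1) hlim, hYlP, ?_, fun ζ hζ => ?_⟩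
  · exact QbarIter_eq_zero_of_tendsto hL j hWu hx hs hWx hP1 (fun m => (hY m).2.1) hYlP hlim fun m => (hY m).2.2.1
  · exact orthogonal_of_tendsto _ (gaugeDir W ζ) hlim fun m => (hY m).2.2.2 ζ hζ

end

end Summit.QuantumFields.BalabanUV.T4Continuum.NE7EnergySliceClosed
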